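import Summits.BirchSwinnertonDyer.BirchSwinnertonDyer.Theorems.EisensteinPrimesKellerYinLemma511NonsplitOfPrint
import Summits.BirchSwinnertonDyer.BirchSwinnertonDyer.Theorems.EisensteinPrimesResidualDevissageNonsplitLambdaIdentityAtNonsplit
import Summits.BirchSwinnertonDyer.BirchSwinnertonDyer.Theorems.EisensteinPrimesResidualCharacterSelmerFiniteOfFact
import Summits.BirchSwinnertonDyer.BirchSwinnertonDyer.Theorems.EisensteinPrimesXAcImprimitiveNoPTorsion
import Summits.BirchSwinnertonDyer.BirchSwinnertonDyer.Theorems.EisensteinPrimesGrDualImprimitiveOfPrimitiveChar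
import HarnessLib

/-!
# CGLS 2022 Prop. 14 (residual finiteness) POINTWISE from the primitive (f.g., torsion, μ = 0) triple, and the non-split half of
# Keller–Yin Lemma 5.1.1 (`𝔛^{Sf}_f` f.g., Λ-torsion, μ = 0) WITHOUT `prop14_…` / `prop125_…` BY NAME
# (cell `bsd-eis`, width seat `bsd-line-x2-p2` gen 27; crux 4 `BSDpOnCellC` stmt-BirchSwinnertonDyer-19034, line telescope v21 UNCHANGED;
# P4-b of the C2 programme, evidence #59)

WHY. In crux 4's v21 cone CGLS Prop. 14 (`prop14_residualCharacterSelmer_finite`, the FINITENESS clause of Prop. 1.2.5) is not cited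
but DERIVED from `prop125_…` (x2-p2 g11's `ResidualCharacterSelmerFiniteOfFact.prop14_residualCharacterSelmer_finite_of_fact`) and then
consumed whole (`∀ M`) by x2-p2 g4's `KellerYinLemma511NonsplitOfPrint.residualFinite_of_prop14_of_not_split` /
`isTorsion_muInvariant_eq_zero_of_prop14_of_not_split` (⇒ `XAcImprimitiveNoPTorsion.xAc_moduleFinite_isTorsion_muInvariant_of_prop14_of_not_split`,
⇒ `lambdaInvariant_xAc_eq_add_of_not_split_ofPoitouTateAt`, ⇒ the non-split count) and by `TeichmullerPairUnramifiedAtMult.lemma511Nonsplit_of_prop125`.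
For the prop125-free cone (P4) these consumers are re-keyed on the PRIMITIVE unramified triples of the two characters of a residual pair
(the char-MC engines' currency), via this seat's `GrDualImprimitiveOfPrimitiveChar.grDual_moduleFinite_isTorsion_muZero_of_unrDual_primitive`
(p789816): §1 is Prop. 14 POINTWISE (explicit Teichmüller character `θ` and equivariant embedding `M ↪ (F/𝒪)(θ)[p]` instead of the
construction inside g11's proof), §2–§3 are the twins of g4's §2–§3 keyed on a residual pair `(θsub, θquot)` of `E_K[p]` over `K`
(`IsResidualPairOver`; the stable line from x1's `exists_stableLine_of_isResidualPairOver`, the local clauses from g6's `localData_of_not_split`).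

HONEST FRAMING: theorems only (no definition, no named fact, no `sorry`, no instance); CONDITIONAL on the primitive triples `hprimsub`,
`hprimquot` (to be discharged at the count level from BCGKPST Thm. 3.3.1 / de Shalit II.6.4 / Hida Thm. I); the originals stay untouched
(append-only tree); closes no stub, discharges no Literature fact, moves no count (27 names by name of record); nothing «redundant» until
the closure lands (host (C2)); BSD is proved for no curve.

References: [CastellaGrossiLeeSkinner2022] §1.2 Lemma 1.2.4, Prop. 1.2.5 (= arXiv Prop. 14), §1.4 Props. 1.4.1–1.4.2 (arXiv:2008.02571);
[KellerYin2024] Lemma 5.1.1 (arXiv:2402.12781v2 §5.1); [GreenbergVatsal2000] §2 Prop. (2.8); [Washington1997] §13.2; [Brink2007] Cor. 1;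
[SilvermanATAEC1994] V.5.3–5.4; [Castella2018] Def. 2.2.
-/

set_option autoImplicit false
set_option linter.dupNamespace false -- the summit namespace `…BirchSwinnertonDyer.BirchSwinnertonDyer.Theorems` (Sub = Summit, D-0017) trips it

noncomputable section

open scoped Classical Pointwise

namespace Summit.BirchSwinnertonDyer.BirchSwinnertonDyer.Theorems.KellerYinLemma511NonsplitOfPrimitive

open WeierstrassCurve NumberField IsDedekindDomain Field
  Literature.NumberTheory.EllipticCurves Literature.NumberTheory.EllipticCurves.IwasawaAlgebra
  Literature.NumberTheory.EllipticCurves.GreenbergSelmer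
  Literature.NumberTheory.EllipticCurves.GreenbergVatsal2000
  Literature.NumberTheory.GaloisRepresentations IsDedekindDomain.HeightOneSpectrum
  Literature.NumberTheory.EllipticCurves.Rank1Residual Literature.NumberTheory.EllipticCurves.KellerYin2024
  Summit.BirchSwinnertonDyer.Rank1Residual.X11b Summit.BirchSwinnertonDyer.Rank1Residual.X11b.AcSelmer
  Summit.BirchSwinnertonDyer.Rank1Residual.X2.ResidualDevissageModules
  Summit.BirchSwinnertonDyer.BirchSwinnertonDyer.Theorems
  Summit.BirchSwinnertonDyer.BirchSwinnertonDyer.Theorems.CumulativeHeegnerInclusionAtThreeResidualDevissage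
  Summit.BirchSwinnertonDyer.BirchSwinnertonDyer.Theorems.ResidualDevissageNonsplitLocalData
  Summit.BirchSwinnertonDyer.BirchSwinnertonDyer.Theorems.ResidualDevissageNonsplitLambdaIdentityOfFacts
  Summit.BirchSwinnertonDyer.BirchSwinnertonDyer.Theorems.ResidualDevissageNonsplitLambdaIdentityAtNonsplit
  Summit.BirchSwinnertonDyer.BirchSwinnertonDyer.Theorems.KellerYinLemma511NonsplitOfPrint

variable {p : ℕ} [hp : Fact p.Prime]

/-! ## §1 CGLS Prop. 14 POINTWISE from the primitive triple -/

/-- **CGLS 2022 Prop. 14 («`H¹_{F_Gr}^S(K, M_θ[p])` is finite») POINTWISE, from the PRIMITIVE unramified (f.g., torsion, `μ = 0`) triple.**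
For `K` imaginary quadratic, `p` odd, `κ` anticyclotomic with topological generator `γ`, a place `𝔭` (`= v̄`), a Teichmüller character
`θ : Γ_K → GL₁(𝒪)` with `D_𝔭` not fixing `(F/𝒪)(θ)[p]` pointwise, a discrete `Γ_K`-module `M` with an equivariant embedding
`j : M ↪ (F/𝒪)(θ)` onto the `p`-torsion, and `S` a finset of places prime to `p` over rational primes split in `K`: if EVERY unramified primitive
dual datum of `(F/𝒪)(θ)` is f.g. `Λ`-torsion with `μ = 0` (`hprim`), then the `S`-imprimitive STRICT Selmer group of `M` over `K_∞` is FINITE.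
Proof: the triple for every strict dual at `S` (this seat's `grDual_moduleFinite_isTorsion_muZero_of_unrDual_primitive`), g8/g9's bridge
`H¹_{𝓕_Gr^S} = H¹_{𝓕_nr^S}` and transfer to the unramified duals at `S`, then x1 LEAD g3's Kummer/Pontryagin finiteness
`CharResidualSelmerFinite.finite_residualStrictSelmer_of_forall_dualData` (Lemma 1.2.4). The pointwise twin of g11's
`prop14_residualCharacterSelmer_finite_of_fact` (which takes `prop125_…` whole and constructs `θ`).
[cite: CastellaGrossiLeeSkinner2022, §1.2 Prop. 1.2.5 ("Moreover, H¹_{F_Gr}^S(K, M_θ[p]) is finite") and Lemma 1.2.4 (arXiv:2008.02571 Prop. 14, Lemma 13)]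
[cite: KellerYin2024, Lemma 1.2.4, Rem. 1.2.3 (i) (arXiv:2402.12781v2)] [cite: Washington1997, §13.2] -/
theorem residualStrictSelmer_finite_of_primitive
    {K : Type} [Field K] [NumberField K] (hK : IsImaginaryQuadratic K) (hp2 : p ≠ 2)
    (κ : ZpExtension K p) (hκ : κ.IsAnticyclotomic) {γ : absoluteGaloisGroup K} (hγ : κ.IsTopGenerator γ)
    (𝔭 : HeightOneSpectrum (𝓞 K))
    {M : Type} [AddCommGroup M] [DistribMulAction (absoluteGaloisGroup K) M] [TopologicalSpace M] [DiscreteTopology M]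
    (θ : FramedGaloisRep K (padicCoeffIntegers (∅ : Set (PadicAlgCl p))) 1)
    (hθ : ∀ σ : absoluteGaloisGroup K, θ σ ^ (p - 1) = 1)
    (j : M →+ charModule (∅ : Set (PadicAlgCl p)) θ)
    (hj : ∀ (σ : absoluteGaloisGroup K) (a : M), j (σ • a) = σ • j a) (hinj : Function.Injective j)
    (hrange : ∀ x : charModule (∅ : Set (PadicAlgCl p)) θ, x ∈ j.range ↔ p • x = 0)
    (S : Finset (HeightOneSpectrum (𝓞 K)))
    (hSmem : ∀ v ∈ S, ((p : ℕ) : 𝓞 K) ∉ v.asIdeal ∧ ((v.asIdeal.under ℤ).primesOver (𝓞 K)).ncard = 2)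
    (hne1 : ¬ ∀ g ∈ decomp 𝔭, ∀ m : charModule (∅ : Set (PadicAlgCl p)) θ, p • m = 0 → g • m = m)
    (hprim : ∀ D : DatumDualData κ γ (charModule (∅ : Set (PadicAlgCl p)) θ)
      (Castella2018.AcSelmer.bdpData (charModule (∅ : Set (PadicAlgCl p)) θ) p 𝔭) (∅ : Set (HeightOneSpectrum (𝓞 K))),
      Module.Finite (IwasawaAlgebra p) D.X ∧ Module.IsTorsion (IwasawaAlgebra p) D.X ∧ muInvariant p D.X = 0) :
    (datumStrictSelmer κ.kerSubgroup M p (Castella2018.AcSelmer.bdpData M p 𝔭) (↑S : Set (HeightOneSpectrum (𝓞 K))) :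
      Set (Literature.NumberTheory.EllipticCurves.subgroupH1 κ.kerSubgroup M)).Finite := by
  -- the triple for every STRICT dual datum at `S`
  have hP : ∀ G : GrDualData κ (charModule (∅ : Set (PadicAlgCl p)) θ) 𝔭 (↑S : Set (HeightOneSpectrum (𝓞 K))) γ,
      Module.Finite (IwasawaAlgebra p) G.X ∧ Module.IsTorsion (IwasawaAlgebra p) G.X ∧ muInvariant p G.X = 0 := fun G ↦
    GrDualImprimitiveOfPrimitiveChar.grDual_moduleFinite_isTorsion_muZero_of_unrDual_primitive hK hp2 κ hκ hγ 𝔭 θ hθ hne1 S hSmem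
      hprim G
  -- the bridge `H¹_{𝓕_Gr^S} = H¹_{𝓕_nr^S}` (unconditional for `θ|_{G_v̄} ≠ 𝟙`) and transfer to the UNRAMIFIED dual data at `S`
  have hbridge := StrictEqUnramifiedCentral.grSelmer_charModule_eq_unrSelmer κ 𝔭 (↑S : Set (HeightOneSpectrum (𝓞 K))) θ hθ hne1
  have hS' : ∀ D : DatumDualData κ γ (charModule (∅ : Set (PadicAlgCl p)) θ)
      (Castella2018.AcSelmer.bdpData (charModule (∅ : Set (PadicAlgCl p)) θ) p 𝔭) (↑S : Set (HeightOneSpectrum (𝓞 K))),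
      Module.Finite (IwasawaAlgebra p) D.X ∧ Module.IsTorsion (IwasawaAlgebra p) D.X ∧ muInvariant p D.X = 0 := fun D ↦
    StrictEqUnramifiedCentral.prop_datumDualData_of_forall_grDualData κ 𝔭 (↑S : Set (HeightOneSpectrum (𝓞 K))) hbridge
      (fun X _ _ ↦ Module.Finite (IwasawaAlgebra p) X ∧ Module.IsTorsion (IwasawaAlgebra p) X ∧ muInvariant p X = 0) hP D
  -- Kummer + Pontryagin (x1 LEAD g3)
  exact CharResidualSelmerFinite.finite_residualStrictSelmer_of_forall_dualData θ κ 𝔭 (↑S : Set (HeightOneSpectrum (𝓞 K))) hθ j hj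
    hinj hrange hγ hS'

/-! ## §2 `Sel_v̄^{Sf}(K_∞, E_K[p^∞])[p]` is finite at a non-split multiplicative Eisenstein datum, from the primitive triples -/

/-- **[prop14-DROP twin of x2-p2 g4's `residualFinite_of_prop14_of_not_split`: `(hfact : prop14_…)` ↦ a residual pair `(θsub, θquot)` of
`E_K[p]` over `K` (`IsResidualPairOver`) + the primitive unramified triples `hprimsub`, `hprimquot`; the internal choice of a rational line is
replaced by the pair's stable line (x1's `exists_stableLine_of_isResidualPairOver`) with its local clauses from g6's `localData_of_not_split`,
and Prop. 14 at `S.Sub` / `S.Quot` by §1; the original docstring follows with that substitution.]** **`{s ∈ Sel_v̄^{Sf}(K_∞, E_K[p^∞]) : p s = 0}`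
is FINITE at every NON-SPLIT multiplicative Eisenstein datum** (`2 < p`, `Mult`, `K` imaginary quadratic Heegner for `N_E`, `(p)` split,
`v̄ ∋ p`, `κ` anticyclotomic with topological generator `γ`, `Sf` = places over `N_E` off `p`): `Sf` is prime to `p` over split rational
primes and `E_K` is good off it; `E_K[p]`, `S`, `E_K[p]/S` are unramified at the places `∉ Sf` prime to `p`; §1 for `M = S.Sub` and
`M = S.Quot`; the devissage + Kummer step `finite_selmerAc_pTorsion_of_line_devissage` with Brink's `D_{v̄} ⊄ ker κ`.
[cite: CastellaGrossiLeeSkinner2022, §1.2 Prop. 14, §1.4 Props. 17–18 (arXiv:2008.02571; Invent. Math. 227 (2022))]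
[cite: KellerYin2024, Lemma 5.1.1 (arXiv:2402.12781v2 §5.1 TeX L1744–1749)] [cite: SilvermanATAEC1994, Ch. V Thm. 5.3, Cor. 5.4] [cite: Brink2007, Cor. 1] -/
theorem residualFinite_of_primitive_of_not_split
    (W : WeierstrassCurve ℚ) [W.IsElliptic] [W.IsGloballyMinimal]
    (K : Type) [Field K] [NumberField K] (vbar : HeightOneSpectrum (𝓞 K))
    (κ : ZpExtension K p) (γ : absoluteGaloisGroup K) [hγ : Fact (κ.IsTopGenerator γ)]
    (Sf : Finset (HeightOneSpectrum (𝓞 K)))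
    (hp2 : 2 < p) (hmult : Mult W p) (hns : ¬ W.HasSplitMultiplicativeReductionAtPrime p)
    (hK : IsImaginaryQuadratic K) (hH : SatisfiesHeegnerHypothesis (W.conductorNorm ℤ) K)
    (hsplit : ((Ideal.span {(p : ℤ)}).primesOver (𝓞 K)).ncard = 2)
    (hvbar : ((p : ℕ) : 𝓞 K) ∈ vbar.asIdeal) (hκ : κ.IsAnticyclotomic)
    (hSf : ∀ w : HeightOneSpectrum (𝓞 K), w ∈ Sf ↔
      (((W.conductorNorm ℤ : ℤ) : 𝓞 K) ∈ w.asIdeal ∧ ((p : ℕ) : 𝓞 K) ∉ w.asIdeal))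
    (θsub θquot : FramedGaloisRep K (padicCoeffIntegers (∅ : Set (PadicAlgCl p))) 1)
    (hpair : IsResidualPairOver (W.baseChange K) p θsub θquot)
    (hprimsub : ∀ D : DatumDualData κ γ (charModule (∅ : Set (PadicAlgCl p)) θsub)
      (Castella2018.AcSelmer.bdpData (charModule (∅ : Set (PadicAlgCl p)) θsub) p vbar) (∅ : Set (HeightOneSpectrum (𝓞 K))),
      Module.Finite (IwasawaAlgebra p) D.X ∧ Module.IsTorsion (IwasawaAlgebra p) D.X ∧ muInvariant p D.X = 0)
    (hprimquot : ∀ D : DatumDualData κ γ (charModule (∅ : Set (PadicAlgCl p)) θquot)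
      (Castella2018.AcSelmer.bdpData (charModule (∅ : Set (PadicAlgCl p)) θquot) p vbar) (∅ : Set (HeightOneSpectrum (𝓞 K))),
      Module.Finite (IwasawaAlgebra p) D.X ∧ Module.IsTorsion (IwasawaAlgebra p) D.X ∧ muInvariant p D.X = 0) :
    Set.Finite {s : selmerAc (W.baseChange K) p κ vbar (↑Sf : Set (HeightOneSpectrum (𝓞 K))) | p • s = 0} := by
  have hpp : p.Prime := hp.out
  have hp2' : p ≠ 2 := by omega
  haveI hEK : (W.baseChange K).IsElliptic := inferInstanceAs (W.map (algebraMap ℚ K)).IsElliptic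
  -- the residual pair's stable line `S ≤ E_K[p]`, its embeddings, and the local clauses at `v̄` (non-split Tate curve)
  obtain ⟨S, hSub, -, ⟨jsub, hjsub, hjsub_inj, hjsub_range⟩, ⟨jquot, hjquot, hjquot_inj, hjquot_range⟩⟩ :=
    ResidualPairStableLine.exists_stableLine_of_isResidualPairOver (W.baseChange K) hpair
  obtain ⟨-, hnon1, hnon2, -, -, hfix⟩ := localData_of_not_split W K vbar κ hp2 hmult hns hK hsplit hvbar S hSub
  have hθsub : ∀ σ : absoluteGaloisGroup K, θsub σ ^ (p - 1) = 1 := fun σ ↦ (hpair.pow_sub_one σ).1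
  have hθquot : ∀ σ : absoluteGaloisGroup K, θquot σ ^ (p - 1) = 1 := fun σ ↦ (hpair.pow_sub_one σ).2
  have hne1sub : ¬ ∀ g ∈ decomp vbar, ∀ m : charModule (∅ : Set (PadicAlgCl p)) θsub, p • m = 0 → g • m = m := fun h ↦
    hnon1 ((forall_smul_eq_iff_of_embedding θsub jsub hjsub hjsub_inj hjsub_range (decomp vbar)).mpr h)
  have hne1quot : ¬ ∀ g ∈ decomp vbar, ∀ m : charModule (∅ : Set (PadicAlgCl p)) θquot, p • m = 0 → g • m = m := fun h ↦
    hnon2 ((forall_smul_eq_iff_of_embedding θquot jquot hjquot hjquot_inj hjquot_range (decomp vbar)).mpr h)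
  -- the imprimitivity set `Sf`: finite, prime to `p`, over split rational primes; good reduction off it
  obtain ⟨hS₀mem, hgood⟩ := sf_split_and_good (p := p) W K Sf hH hSf
  have hSmem : ∀ v ∈ Sf, ((p : ℕ) : 𝓞 K) ∉ v.asIdeal ∧ ((v.asIdeal.under ℤ).primesOver (𝓞 K)).ncard = 2 :=
    fun v hv ↦ hS₀mem v (Finset.mem_coe.mpr hv)
  -- Brink: `v̄` is finitely decomposed in `K_∞`
  have h𝔭dec : ¬ (decomp vbar ≤ κ.kerSubgroup) :=
    ZpExtension.decomp_not_le_kerSubgroup_above_of_isAnticyclotomic_holds K p hK hp2' κ hκ vbar hvbar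
  -- CGLS Prop. 14 for the two characters, POINTWISE from the primitive triples (§1)
  have hΦfin : (datumStrictSelmer κ.kerSubgroup S.Sub p (AcSelmer.bdpData S.Sub p vbar) (↑Sf : Set (HeightOneSpectrum (𝓞 K))) :
      Set (Literature.NumberTheory.EllipticCurves.subgroupH1 κ.kerSubgroup S.Sub)).Finite :=
    residualStrictSelmer_finite_of_primitive hK hp2' κ hκ hγ.out vbar θsub hθsub jsub hjsub hjsub_inj hjsub_range Sf hSmem hne1sub
      hprimsub
  have hΨfin : (datumStrictSelmer κ.kerSubgroup S.Quot p (AcSelmer.bdpData S.Quot p vbar) (↑Sf : Set (HeightOneSpectrum (𝓞 K))) :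
      Set (Literature.NumberTheory.EllipticCurves.subgroupH1 κ.kerSubgroup S.Quot)).Finite :=
    residualStrictSelmer_finite_of_primitive hK hp2' κ hκ hγ.out vbar θquot hθquot jquot hjquot hjquot_inj hjquot_range Sf hSmem
      hne1quot hprimquot
  exact finite_selmerAc_pTorsion_of_line_devissage (W.baseChange K) κ hvbar h𝔭dec hgood S hfix hΦfin hΨfin

/-! ## §3 `𝔛^{Sf}_f` f.g., `Λ`-torsion, `μ = 0` — the non-split half of Keller–Yin Lemma 5.1.1, from the primitive triples -/

/-- **[prop14-DROP twin of g4's `isTorsion_muInvariant_eq_zero_of_prop14_of_not_split` / g18's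
`xAc_moduleFinite_isTorsion_muInvariant_of_prop14_of_not_split`.]** **`𝔛^{Sf}_f = XAc E_K p κ v̄ ↑Sf γ` is finitely generated, `Λ`-torsion,
with `μ(𝔛^{Sf}_f) = 0` at every NON-SPLIT multiplicative Eisenstein datum**, given a residual pair `(θsub, θquot)` of `E_K[p]` over `K` whose
two characters have PRIMITIVE unramified duals f.g. torsion `μ = 0` (`hprimsub`, `hprimquot`): §2 + Greenberg's criterion (A)
(`UniversalToricDescentAcDualMuZero.isTorsion_of_finite_pTorsion` / `muInvariant_eq_zero_of_finite_pTorsion`) + Castella's unconditional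
finite generation (`XAc.module_finite`). The conclusion of `KellerYin2024.lemma511_imprimitive_isTorsion_muInvariant_eq_zero_mult_OPEN` at a
non-split datum, now resting on the primitive triples instead of CGLS Prop. 14 / Prop. 1.2.5 by name.
[cite: CastellaGrossiLeeSkinner2022, §1.2 Prop. 14, §1.4 Props. 17–18 (arXiv:2008.02571)] [cite: KellerYin2024, Lemma 5.1.1 (arXiv:2402.12781v2 §5.1)]
[cite: GreenbergVatsal2000, §2 Prop. (2.8)] [cite: GreenbergLNM1716, §1 p. 60] [cite: Castella2018, §2.1 Def. 2.2 (arXiv:1704.06608 p. 5)] -/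
theorem xAc_moduleFinite_isTorsion_muInvariant_of_primitive_of_not_split
    (W : WeierstrassCurve ℚ) [W.IsElliptic] [W.IsGloballyMinimal]
    (K : Type) [Field K] [NumberField K] (vbar : HeightOneSpectrum (𝓞 K))
    (κ : ZpExtension K p) (γ : absoluteGaloisGroup K) [Fact (κ.IsTopGenerator γ)]
    (Sf : Finset (HeightOneSpectrum (𝓞 K)))
    (hp2 : 2 < p) (hmult : Mult W p) (hns : ¬ W.HasSplitMultiplicativeReductionAtPrime p)
    (hK : IsImaginaryQuadratic K) (hH : SatisfiesHeegnerHypothesis (W.conductorNorm ℤ) K)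
    (hsplit : ((Ideal.span {(p : ℤ)}).primesOver (𝓞 K)).ncard = 2)
    (hvbar : ((p : ℕ) : 𝓞 K) ∈ vbar.asIdeal) (hκ : κ.IsAnticyclotomic)
    (hSf : ∀ w : HeightOneSpectrum (𝓞 K), w ∈ Sf ↔
      (((W.conductorNorm ℤ : ℤ) : 𝓞 K) ∈ w.asIdeal ∧ ((p : ℕ) : 𝓞 K) ∉ w.asIdeal))
    (θsub θquot : FramedGaloisRep K (padicCoeffIntegers (∅ : Set (PadicAlgCl p))) 1)
    (hpair : IsResidualPairOver (W.baseChange K) p θsub θquot)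
    (hprimsub : ∀ D : DatumDualData κ γ (charModule (∅ : Set (PadicAlgCl p)) θsub)
      (Castella2018.AcSelmer.bdpData (charModule (∅ : Set (PadicAlgCl p)) θsub) p vbar) (∅ : Set (HeightOneSpectrum (𝓞 K))),
      Module.Finite (IwasawaAlgebra p) D.X ∧ Module.IsTorsion (IwasawaAlgebra p) D.X ∧ muInvariant p D.X = 0)
    (hprimquot : ∀ D : DatumDualData κ γ (charModule (∅ : Set (PadicAlgCl p)) θquot)
      (Castella2018.AcSelmer.bdpData (charModule (∅ : Set (PadicAlgCl p)) θquot) p vbar) (∅ : Set (HeightOneSpectrum (𝓞 K))),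
      Module.Finite (IwasawaAlgebra p) D.X ∧ Module.IsTorsion (IwasawaAlgebra p) D.X ∧ muInvariant p D.X = 0) :
    Module.Finite (IwasawaAlgebra p) (XAc (W.baseChange K) p κ vbar (↑Sf : Set (HeightOneSpectrum (𝓞 K))) γ) ∧
      Module.IsTorsion (IwasawaAlgebra p) (XAc (W.baseChange K) p κ vbar (↑Sf : Set (HeightOneSpectrum (𝓞 K))) γ) ∧
      muInvariant p (XAc (W.baseChange K) p κ vbar (↑Sf : Set (HeightOneSpectrum (𝓞 K))) γ) = 0 := by
  haveI hEK : (W.baseChange K).IsElliptic := inferInstanceAs (W.map (algebraMap ℚ K)).IsElliptic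
  have hS : (↑Sf : Set (HeightOneSpectrum (𝓞 K))).Finite := Finset.finite_toSet Sf
  have hfin := residualFinite_of_primitive_of_not_split W K vbar κ γ Sf hp2 hmult hns hK hH hsplit hvbar hκ hSf θsub θquot hpair
    hprimsub hprimquot
  exact ⟨XAc.module_finite κ vbar _ γ hS (W := W.baseChange K),
    UniversalToricDescentAcDualMuZero.isTorsion_of_finite_pTorsion (W.baseChange K) p κ vbar _ γ hS hfin,
    UniversalToricDescentAcDualMuZero.muInvariant_eq_zero_of_finite_pTorsion (W.baseChange K) p κ vbar _ γ hS hfin⟩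

end Summit.BirchSwinnertonDyer.BirchSwinnertonDyer.Theorems.KellerYinLemma511NonsplitOfPrimitive

end
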